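import Summits.BirchSwinnertonDyer.Rank1Residual.Additive.X4SharpThreeKimDefectParity
import Summits.BirchSwinnertonDyer.Rank1Residual.Additive.X4SharpThreeKimPartialBridge
import HarnessLib

/-!
# CERTIFICATE FORMS of the parity-relaxed halves: the LOWER half from a Kurihara number ONE LEVEL
# UP, and the `ord_p ∏c ≤ 2` DICHOTOMY `BSD(E,p) ⟺ no cyclic-level UNIT Kurihara number` — at `p ≥ 5`
# from PUBLISHED facts, at `p ≥ 3` on tower rows modulo the ANNOUNCED Kim 2025 clause
# (cell `b2b-bsdres`, seat additive-p4 gen 19, line V36c; CLASS-CLOSURE §3.1/§3.2, E1/E4 for the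
# Kurihara-census lanes KURX / KURREG / E2-AT3)

HONEST FRAMING (cell `b2b-bsdres`, run/shared/lean/b2b/bsd-rank1-residual/, verbatim in every
file): the goal of the cell is to DELETE the COMBINATION-SHAPED residual classes of the
Birch–Swinnerton-Dyer formula for ALL analytic-rank `≤ 1` elliptic curves over `ℚ` — "full BSD
formula for every rank `≤ 1` curve in class `C`" assembled STRICTLY from published theorems — so
that the rank-`≤ 1` remainder becomes exactly the CONSTRUCTION-SHAPED classes, which are TYPED
(missing-input `Prop`s), NOT attempted. This is not "finishing BSD". Sub-cell additive-p4 (X3♯/X4♯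
direct): research route on the CONSTRUCTION-SHAPED class X4; the label X4 and the marks of
RESIDUAL-MAP §I N10/N11 are UNCHANGED; nothing is booked; per-pair certificates are
INSTRUMENTATION, never class theorems. Theorems only (no definition, no named fact minted). §1 uses
PUBLISHED named facts as hypotheses (`hKimk` p249207, `hE67c` p250376 = Kim 2026 Thm. 1.8 (6);
`hCT` Cassels; GZK; modularity); §2 is CONDITIONAL on the ANNOUNCED statement
`Kim2025.thm11_kimShaLength_of_integralPeriod_OPEN` (arXiv:2505.09121 Thm. 1.1, PREPRINT, flag
`Kim2025-preprint`, hypothesis `hK25s`) — an announced preprint enters ONLY as an explicitly labelled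
OPEN hypothesis. The certificate predicate is n1011-p03's `KuriharaIndexLeAt W p f m` (a cyclic
Kolyvagin level `n ∈ 𝒩_k`, `1 ≤ k ≤ m + 1`, surjective `ψ`, `kuriharaNumber f (p^k) n ψ ≠ 0`;
`X4SharpThreeKimRefined.lean`), with p03's `kuriharaIndexLeAt_iff_kuriharaPartialInfty_le`.

## What this file proves

* §1 (`p ≥ 5`, published inputs; analytic rank `0`, `ρ̄_{E,p}` onto, conductor-level datum with
  `p ∤ c_D` and the period transfer, or OPTIMAL):
  `missingLowerBoundAt_of_kuriharaIndexLeAt_tamagawa_succ_of_even` — on a row with `ord_p #Ш_an`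
  EVEN, a Kurihara number non-zero mod `p^k` at a cyclic level with **`k ≤ ord_p ∏_v c_v + 2`**
  certifies the LOWER half (p11's T-N10K consumer needs `k ≤ ord_p ∏_v c_v + 1`: parity buys one
  level — e.g. on `#Ш_an = p²·unit`, `p ∤ ∏c` rows ANY Kurihara number not divisible by `p²` works);
  `bsdp_iff_not_kuriharaIndexLeAt_zero_of_tamagawa_le_two_of_shaAn_unit` (+ `_of_optimal`) — on a
  `p ∤ #Ш_an` row with `1 ≤ ord_p ∏_v c_v ≤ 2`: **`BSD(E,p) ⟺` NO cyclic-level UNIT Kurihara number**.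
* §2 (`p ≥ 3`, tower rows, modulo the preprint): the same two statements
  (`…_of_kim2025_OPEN`, `…_of_optimal_of_kim2025_OPEN`) and the parity-free refutation direction
  `not_bsdp_of_kuriharaIndexLeAt_zero_of_tamagawa_pos_of_kim2025_OPEN` (a unit Kurihara number on a
  unit row with `p ∣ ∏c` REFUTES `BSD(E,p)` modulo the preprint — the anomaly-protocol trigger).
  CONSEQUENCE for N11 (`p = 3`): on the Tamagawa-defect-one rows and on 8 ‖ 1 of the 9 ‖ 1 window
  TAM-DEFECT₂♭ rows (`ord₃ ∏_{ℓ≠3} c_ℓ = 2`; sweep 2 033; seat census V23) the E2-AT3 / KURREG lanes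
  need Kurihara numbers MODULO 3 ONLY: universal divisibility by `3` is exactly the missing input, a
  single unit value refutes. EVIDENCE pointers only; nothing booked; X4 stays CONSTRUCTION-SHAPED.

References: C.-H. Kim, Amer. J. Math. 148 (2026) = arXiv:2203.12159v4, Thm. 1.9 (6), §1.5.1,
Conj. 1.10 [Kim2022StructureSelmer]; C.-H. Kim, arXiv:2505.09121 Thm. 1.1 (PREPRINT)
[Kim2025RefinedTNC]; Cassels 1962 / Silverman *AEC* Thm. X.4.14 [SilvermanAEC2009]; Miller 2011
Def. 1.1 [Miller2011LMS]; Cremona *Algorithms* §2.8 [CremonaAlgorithms1997]; siblings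
`X4/KimDefectParity.lean`, `Additive/X4SharpThreeKimDefectParity.lean` (this seat, gen 19),
`X4/KuriharaLowerHalf.lean` (n1011-p11), `Additive/X4SharpThreeKimPartialBridge.lean` (n1011-p03).
-/

noncomputable section

open scoped Classical MatrixGroups ModularForm

open Complex CongruenceSubgroup WeierstrassCurve Literature.NumberTheory.EllipticCurves
  Literature.NumberTheory.EllipticCurves.ModularForms
  Literature.NumberTheory.EllipticCurves.Rank1Residual
  Literature.NumberTheory.EllipticCurves.Rank1Residual.Typed

namespace Summit.BirchSwinnertonDyer.Rank1Residual.Additive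

section Published

variable (W : WeierstrassCurve ℚ) [W.IsElliptic] [W.IsGloballyMinimal] (p : ℕ) [Fact p.Prime]

/-! ### §1 `p ≥ 5`, PUBLISHED inputs: certificate forms of the parity-relaxed halves -/

/-- **LOWER half from a Kurihara number ONE LEVEL UP, `p ≥ 5`, even row.** Analytic rank `0`,
`ρ̄_{E,p}` onto, conductor-level datum `D` with `p ∤ c_D` and the period transfer, Kim's (6)
(`hKimk`, `hE67c`), Cassels (`hCT`), GZK, modularity; `#Ш_an = q'` with `ord_p q'` EVEN. A
certificate `KuriharaIndexLeAt W p D.f (ord_p ∏_v c_v + 1)` — a cyclic level `n ∈ 𝒩_k` with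
`k ≤ ord_p ∏_v c_v + 2` and `δ̃_n^{(k)} ≠ 0` — gives `Typed.MissingLowerBoundAt W p`. (p11's
`X4.missingLowerBoundAt_rankZero_of_kimLower` needs `k ≤ ord_p ∏_v c_v + 1`; parity buys one level:
on a LOWER row with `p ∤ ∏c` and `#Ш_an = p²·unit` ANY Kurihara number not divisible by `p²`
certifies the lower half, not only a unit one.) [cite: Kim2022StructureSelmer, Thm. 1.9 (6) (PDF p. 8), §1.5.1 (PDF p. 7)]
[cite: SilvermanAEC2009, Thm. X.4.14] [cite: Miller2011LMS, Def. 1.1] -/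
theorem missingLowerBoundAt_of_kuriharaIndexLeAt_tamagawa_succ_of_even
    (hKimk : Kim2026.rankZero_le_padicValNat_sha_of_kuriharaNumber_ne_zero)
    (hE67c : Kim2026.rankZero_padicValNat_sha_add_le_of_forall_pow_dvd_kuriharaNumber_cyclicLevel)
    (hCT : exists_casselsTate_pairing (K := ℚ))
    (hGZK : rank_eq_analyticRank_of_analyticRank_le_one) (hmod : hasEntireLFunction_rat)
    (hp : 5 ≤ p) (hr : W.analyticRank = 0) (hsurj : W.HasSurjectiveModNGaloisRep p)
    {N : ℕ} [NeZero N] (D : ModularParametrizationData W N) (hN : W.conductorNorm ℤ = N)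
    (hc : ¬ (p : ℤ) ∣ D.maninConstant)
    (hper : ∃ u : ℚ, ‖(u : ℚ_[p])‖ = 1 ∧ W.realPeriodRat = u * plusPeriod D.f)
    {q' : ℚ} (hq' : shaAn W = (q' : ℂ)) (hev : Even (padicValRat p q'))
    (hcert : KuriharaIndexLeAt W p D.f (padicValNat p W.tamagawaProduct + 1)) :
    MissingLowerBoundAt W p :=
  X4.missingLowerBoundAt_of_kimDefect_le_tamagawa_add_one_of_even W p hKimk hE67c hCT hGZK hmod hp hr
    hsurj D hN hc hper hq' hev
    (by exact_mod_cast kuriharaPartialInfty_le_of_kuriharaIndexLeAt W p D.f hcert)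

/-- **THE `ord_p ∏c ≤ 2` DICHOTOMY in certificate language, `p ≥ 5`, PUBLISHED inputs**: on a unit
row (`#Ш_an = q'`, `ord_p q' = 0`) with `1 ≤ ord_p ∏_v c_v ≤ 2` — the Tamagawa-defect-one rows and
the bulk of the TAM-DEFECT₂♭ residue of X4♯ at `p ≥ 5` —
**`BSD(E,p) ⟺ ¬ KuriharaIndexLeAt W p D.f 0`**, i.e. iff NO cyclic-level Kurihara number of `D.f`
is a `p`-adic unit. (`→`: `BSD(E,p)` is Conjecture 1.10 at the pair (gen 17's iff), so
`∂^{(∞)} = ord_p ∏c ≥ 1`, and a unit would force `∂^{(∞)} ≤ 0`; `←`: no unit means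
`1 ≤ ∂^{(∞)}` (p03's `kuriharaIndexLeAt_iff_kuriharaPartialInfty_le`), and the ONE-FACTOR socket of
`X4/KimDefectParity.lean` with `α = 1` closes.) So on these rows a unit Kurihara number REFUTES
`BSD(E,p)`, and "every cyclic Kurihara number is divisible by `p`" — half of Conjecture 1.10's
`∂^{(∞)} = 2` — is exactly the missing input. [cite: Kim2022StructureSelmer, Thm. 1.9 (6) and Conj. 1.10 (PDF p. 8)]
[cite: SilvermanAEC2009, Thm. X.4.14] [cite: Miller2011LMS, §1 and Def. 1.1] -/
theorem bsdp_iff_not_kuriharaIndexLeAt_zero_of_tamagawa_le_two_of_shaAn_unit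
    (hKimk : Kim2026.rankZero_le_padicValNat_sha_of_kuriharaNumber_ne_zero)
    (hE67c : Kim2026.rankZero_padicValNat_sha_add_le_of_forall_pow_dvd_kuriharaNumber_cyclicLevel)
    (hCT : exists_casselsTate_pairing (K := ℚ))
    (hGZK : rank_eq_analyticRank_of_analyticRank_le_one) (hmod : hasEntireLFunction_rat)
    (hp : 5 ≤ p) (hr : W.analyticRank = 0) (hsurj : W.HasSurjectiveModNGaloisRep p)
    {N : ℕ} [NeZero N] (D : ModularParametrizationData W N) (hN : W.conductorNorm ℤ = N)
    (hc : ¬ (p : ℤ) ∣ D.maninConstant)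
    (hper : ∃ u : ℚ, ‖(u : ℚ_[p])‖ = 1 ∧ W.realPeriodRat = u * plusPeriod D.f)
    {q' : ℚ} (hq' : shaAn W = (q' : ℂ)) (hv : padicValRat p q' = 0)
    (hc1 : 1 ≤ padicValNat p W.tamagawaProduct) (hc2 : padicValNat p W.tamagawaProduct ≤ 2) :
    BSDp W p ↔ ¬ KuriharaIndexLeAt W p D.f 0 := by
  rw [kuriharaIndexLeAt_iff_kuriharaPartialInfty_le]
  constructor
  · intro h hle
    have hK : X4.KimTamagawaDefectAt W p D.f :=
      (X4.bsdp_iff_kimTamagawaDefectAt_of_kimFacts_of_five_le W p hKimk hE67c hGZK hmod hp hr hsurj D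
        hN hc hper).mp h
    rw [X4.KimTamagawaDefectAt] at hK
    rw [hK] at hle
    have : padicValNat p W.tamagawaProduct ≤ 0 := by exact_mod_cast hle
    omega
  · intro hno
    have h1 : ((1 : ℕ) : ℕ∞) ≤ kuriharaPartialInfty W p D.f := by
      have h := Order.add_one_le_of_lt (not_le.mp hno)
      simpa using h
    exact X4.bsdp_of_le_kimDefect_of_tamagawa_le_add_one_of_shaAn_unit W p hKimk hE67c hCT hGZK hmod hp
      hr hsurj D hN hc hper hq' hv h1 (by omega)

/-- The same dichotomy on an OPTIMAL conductor-level datum (`Λ_E = c·Λ_f`, `p ∤ c`), `p ≥ 5` —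
the census shape (Cremona optimality + one `surj(p)` bit + the Tamagawa list + `p ∤ #Ш_an`).
[cite: Kim2022StructureSelmer, Thm. 1.9 (6) and Conj. 1.10 (PDF p. 8)] [cite: SilvermanAEC2009, Thm. X.4.14]
[cite: Miller2011LMS, §1 and Def. 1.1] [cite: CremonaAlgorithms1997, §2.8 (p. 26)] -/
theorem bsdp_iff_not_kuriharaIndexLeAt_zero_of_tamagawa_le_two_of_shaAn_unit_of_optimal
    (hKimk : Kim2026.rankZero_le_padicValNat_sha_of_kuriharaNumber_ne_zero)
    (hE67c : Kim2026.rankZero_padicValNat_sha_add_le_of_forall_pow_dvd_kuriharaNumber_cyclicLevel)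
    (hCT : exists_casselsTate_pairing (K := ℚ))
    (hGZK : rank_eq_analyticRank_of_analyticRank_le_one) (hmod : hasEntireLFunction_rat)
    (hp : 5 ≤ p) (hr : W.analyticRank = 0) (hsurj : W.HasSurjectiveModNGaloisRep p)
    {N : ℕ} [NeZero N] (D : ModularParametrizationData W N) (hN : W.conductorNorm ℤ = N)
    (hopt : ∀ z ∈ D.L.lattice, ∃ w ∈ periodLattice D.f, z = D.c * w)
    (hc : ¬ (p : ℤ) ∣ D.maninConstant)
    {q' : ℚ} (hq' : shaAn W = (q' : ℂ)) (hv : padicValRat p q' = 0)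
    (hc1 : 1 ≤ padicValNat p W.tamagawaProduct) (hc2 : padicValNat p W.tamagawaProduct ≤ 2) :
    BSDp W p ↔ ¬ KuriharaIndexLeAt W p D.f 0 :=
  bsdp_iff_not_kuriharaIndexLeAt_zero_of_tamagawa_le_two_of_shaAn_unit W p hKimk hE67c hCT hGZK hmod
    hp hr hsurj D hN hc (X4.periodTransfer_of_optimal p D hopt hc) hq' hv hc1 hc2

end Published

section Announced

variable (W : WeierstrassCurve ℚ) [W.IsElliptic] [W.IsGloballyMinimal] (p : ℕ) [Fact p.Prime]

/-! ### §2 `p ≥ 3` on TOWER rows, CONDITIONAL on the announced Kim 2025 clause: the same certificates -/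

/-- **LOWER half from a Kurihara number ONE LEVEL UP, `p ≥ 3`, even tower row, CONDITIONAL on the
preprint** (`hK25s`, flag `Kim2025-preprint`): `KuriharaIndexLeAt W p D.f (ord_p ∏_v c_v + 1)` on a
row with `#Ш_an = q'`, `ord_p q'` even ⟹ `Typed.MissingLowerBoundAt W p`. At `p = 3`: the N11
LOWER rows (`#Ш_an = 9·unit`, `3 ∤ ∏c`: 69 window rows) are certified by ANY cyclic Kurihara number
not divisible by `9`, at a level `k ≤ 2`. [claim: Kim2025RefinedTNC, status: under-review]
[cite: Kim2025RefinedTNC, Thm. 1.1 ("BSD") (ANNOUNCED, OPEN binder)] [cite: SilvermanAEC2009, Thm. X.4.14]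
[cite: Miller2011LMS, Def. 1.1] -/
theorem missingLowerBoundAt_of_kuriharaIndexLeAt_tamagawa_succ_of_even_of_kim2025_OPEN
    (hK25s : Kim2025.thm11_kimShaLength_of_integralPeriod_OPEN)
    (hCT : exists_casselsTate_pairing (K := ℚ))
    (hGZK : rank_eq_analyticRank_of_analyticRank_le_one) (hmod : hasEntireLFunction_rat)
    (hp3 : 3 ≤ p) (hr : W.analyticRank = 0) (htower : ∀ n : ℕ, W.HasSurjectiveModNGaloisRep (p ^ n : ℕ))
    {N : ℕ} [NeZero N] (D : ModularParametrizationData W N)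
    (hper : ∃ u : ℚ, ‖(u : ℚ_[p])‖ = 1 ∧ W.realPeriodRat = u * plusPeriod D.f)
    {q' : ℚ} (hq' : shaAn W = (q' : ℂ)) (hev : Even (padicValRat p q'))
    (hcert : KuriharaIndexLeAt W p D.f (padicValNat p W.tamagawaProduct + 1)) :
    MissingLowerBoundAt W p :=
  missingLowerBoundAt_of_kimDefect_le_tamagawa_add_one_of_even_of_kim2025_OPEN W p hK25s hCT hGZK hmod
    hp3 hr htower D hper hq' hev
    (by exact_mod_cast kuriharaPartialInfty_le_of_kuriharaIndexLeAt W p D.f hcert)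

/-- **THE `ord_p ∏c ≤ 2` DICHOTOMY in certificate language, `p ≥ 3`, unit tower row, CONDITIONAL on
the preprint**: `1 ≤ ord_p ∏_v c_v ≤ 2`, `#Ш_an` a `p`-unit ⟹ **`BSD(E,p) ⟺ ¬ KuriharaIndexLeAt W p D.f 0`**
(no cyclic-level unit Kurihara number). At `p = 3` this covers the Tamagawa-defect-one rows and 8 ‖ 1
of the 9 ‖ 1 window TAM-DEFECT₂♭ rows of N11 (`ord₃ ∏_{ℓ≠3} c_ℓ = 2`; sweep 2 033): for them the E2-AT3
/ KURREG lanes need Kurihara numbers MODULO 3 ONLY — a unit refutes `BSD(E,3)` modulo the preprint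
(anomaly protocol), universal divisibility by `3` is the missing input.
[claim: Kim2025RefinedTNC, status: under-review]
[cite: Kim2025RefinedTNC, Thm. 1.1 ("BSD") (ANNOUNCED, OPEN binder)] [cite: SilvermanAEC2009, Thm. X.4.14]
[cite: Kim2022StructureSelmer, Conj. 1.10 (PDF p. 8)] [cite: Miller2011LMS, §1 and Def. 1.1] -/
theorem bsdp_iff_not_kuriharaIndexLeAt_zero_of_tamagawa_le_two_of_shaAn_unit_of_kim2025_OPEN
    (hK25s : Kim2025.thm11_kimShaLength_of_integralPeriod_OPEN)
    (hCT : exists_casselsTate_pairing (K := ℚ))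
    (hGZK : rank_eq_analyticRank_of_analyticRank_le_one) (hmod : hasEntireLFunction_rat)
    (hp3 : 3 ≤ p) (hr : W.analyticRank = 0) (htower : ∀ n : ℕ, W.HasSurjectiveModNGaloisRep (p ^ n : ℕ))
    {N : ℕ} [NeZero N] (D : ModularParametrizationData W N)
    (hper : ∃ u : ℚ, ‖(u : ℚ_[p])‖ = 1 ∧ W.realPeriodRat = u * plusPeriod D.f)
    {q' : ℚ} (hq' : shaAn W = (q' : ℂ)) (hv : padicValRat p q' = 0)
    (hc1 : 1 ≤ padicValNat p W.tamagawaProduct) (hc2 : padicValNat p W.tamagawaProduct ≤ 2) :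
    BSDp W p ↔ ¬ KuriharaIndexLeAt W p D.f 0 := by
  rw [bsdp_iff_one_le_kimDefect_of_tamagawa_le_two_of_shaAn_unit_of_kim2025_OPEN W p hK25s hCT hGZK
    hmod hp3 hr htower D hper hq' hv hc1 hc2, kuriharaIndexLeAt_iff_kuriharaPartialInfty_le, not_le]
  constructor
  · intro h1
    exact lt_of_lt_of_le (by exact_mod_cast Nat.zero_lt_one) h1
  · intro h0
    have h := Order.add_one_le_of_lt h0
    simpa using h

/-- The same dichotomy on an OPTIMAL datum with `p ∤ c`, `p ≥ 3`, unit tower row, CONDITIONAL on the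
preprint — the census shape for Cremona's optimal curves at `3` on the N11 TAM-DEFECT₂♭ rows.
[claim: Kim2025RefinedTNC, status: under-review]
[cite: Kim2025RefinedTNC, Thm. 1.1 ("BSD") (ANNOUNCED, OPEN binder)] [cite: Miller2011LMS, §1 and Def. 1.1]
[cite: CremonaAlgorithms1997, §2.8 (p. 26)] -/
theorem bsdp_iff_not_kuriharaIndexLeAt_zero_of_tamagawa_le_two_of_shaAn_unit_of_optimal_of_kim2025_OPEN
    (hK25s : Kim2025.thm11_kimShaLength_of_integralPeriod_OPEN)
    (hCT : exists_casselsTate_pairing (K := ℚ))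
    (hGZK : rank_eq_analyticRank_of_analyticRank_le_one) (hmod : hasEntireLFunction_rat)
    (hp3 : 3 ≤ p) (hr : W.analyticRank = 0) (htower : ∀ n : ℕ, W.HasSurjectiveModNGaloisRep (p ^ n : ℕ))
    {N : ℕ} [NeZero N] (D : ModularParametrizationData W N)
    (hopt : ∀ z ∈ D.L.lattice, ∃ w ∈ periodLattice D.f, z = D.c * w)
    (hc : ¬ (p : ℤ) ∣ D.maninConstant)
    {q' : ℚ} (hq' : shaAn W = (q' : ℂ)) (hv : padicValRat p q' = 0)
    (hc1 : 1 ≤ padicValNat p W.tamagawaProduct) (hc2 : padicValNat p W.tamagawaProduct ≤ 2) :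
    BSDp W p ↔ ¬ KuriharaIndexLeAt W p D.f 0 :=
  bsdp_iff_not_kuriharaIndexLeAt_zero_of_tamagawa_le_two_of_shaAn_unit_of_kim2025_OPEN W p hK25s hCT
    hGZK hmod hp3 hr htower D (X4.periodTransfer_of_optimal p D hopt hc) hq' hv hc1 hc2

/-- **Refutation direction, parity-free, `p ≥ 3`, tower row, CONDITIONAL on the preprint**: on a unit
row with `1 ≤ ord_p ∏_v c_v` a cyclic-level UNIT Kurihara number (`KuriharaIndexLeAt W p D.f 0`) gives
`¬ BSD(E,p)` (clause (6) with `∂^{(∞)} = 0` makes `ord_p #Ш = ord_p ∏_v c_v ≥ 1 > 0 = ord_p #Ш_an`).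
The anomaly-protocol trigger for the N11 census, stated on its own (no `ord_p ∏c ≤ 2` needed).
[claim: Kim2025RefinedTNC, status: under-review]
[cite: Kim2025RefinedTNC, Thm. 1.1 ("BSD") (ANNOUNCED, OPEN binder)] [cite: Kim2022StructureSelmer, Conj. 1.10 (PDF p. 8)]
[cite: Miller2011LMS, §1 and Def. 1.1] -/
theorem not_bsdp_of_kuriharaIndexLeAt_zero_of_tamagawa_pos_of_kim2025_OPEN
    (hK25s : Kim2025.thm11_kimShaLength_of_integralPeriod_OPEN)
    (hGZK : rank_eq_analyticRank_of_analyticRank_le_one) (hmod : hasEntireLFunction_rat)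
    (hp3 : 3 ≤ p) (hr : W.analyticRank = 0) (htower : ∀ n : ℕ, W.HasSurjectiveModNGaloisRep (p ^ n : ℕ))
    {N : ℕ} [NeZero N] (D : ModularParametrizationData W N)
    (hper : ∃ u : ℚ, ‖(u : ℚ_[p])‖ = 1 ∧ W.realPeriodRat = u * plusPeriod D.f)
    (hc1 : 1 ≤ padicValNat p W.tamagawaProduct) (hunit : KuriharaIndexLeAt W p D.f 0) :
    ¬ BSDp W p := by
  have hp2 : p ≠ 2 := by omega
  have hint := forall_padicValRat_ratPlusSymbol_nonneg_of_towerSurj hp2 D.isNewformOf htower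
  intro h
  have hK : X4.KimTamagawaDefectAt W p D.f :=
    (bsdp_iff_kimTamagawaDefectAt_of_kim2025_OPEN W p hK25s hGZK hmod hp3 hr htower D hper hint).mp h
  have hle := kuriharaPartialInfty_le_of_kuriharaIndexLeAt W p D.f hunit
  rw [X4.KimTamagawaDefectAt] at hK
  rw [hK] at hle
  have : padicValNat p W.tamagawaProduct ≤ 0 := by exact_mod_cast hle
  omega

end Announced

end Summit.BirchSwinnertonDyer.Rank1Residual.Additive

end
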